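import Summits.CriticalPhenomena.SAWScalingLimit.Theses.SAWRestrictionRigidity
import Summits.CriticalPhenomena.SAWScalingLimit.Theorems.SAWRestrictionRigidityRigidityClosureHomeomorph

/-!
# Stub `stub_covarianceOfImages` of line `registered` (reshape v5, dichotomy + reference-disc cut), crux `Rigidity` (stmt-CriticalPhenomena-1368), route SAWRestrictionRigidity

Target: `Summits/CriticalPhenomena/SAWScalingLimit/Theorems/SAWRestrictionRigidityRigidityCovarianceOfImages.lean`
(`--supports stmt-CriticalPhenomena-1368`).

**Covariance of images.** If the law of every Dobrushin domain `D₀` transports correctly,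
`P D' = Φ_* P D₀`, along every `Φ : C(ℂ, ℂ)` complex differentiable on `D₀.carrier` and
injective on `closure D₀.carrier` (with `D'` the Dobrushin domain of carrier `Φ '' D₀.carrier`
and marks `Φ a`, `Φ b`), then `P` is conformally covariant
(`ChordalFamily.IsConformallyCovariant`).

Proof. Given a conformal equivalence `g : D → D'` with the marks as boundary values and a
continuous plane map `Φ` agreeing with `g` on `D`, the closure-homeomorphism lemma
(`Cocycle.stub_closureHomeomorph`, Riemann mapping theorem + Carathéodory) says `Φ` is injective
on `closure D`, `Φ '' D = D'` and `Φ a = a'`, `Φ b = b'`; `Φ` is complex differentiable on `D`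
because it agrees there with `g`. The hypothesis applied to `(D, D', Φ)` is the claim.

References: G. F. Lawler, *Conformally Invariant Processes in the Plane* (2005), §6.1
(transport of chordal laws by conformal maps); Ch. Pommerenke, *Boundary Behaviour of Conformal
Maps* (1992), Thm. 2.6 (Carathéodory).
-/

noncomputable section

namespace Summit.CriticalPhenomena.SAWScalingLimit.Cruxes.Rigidity.Dichotomy

open MeasureTheory Set Filter Topology
open Literature.Probability.RandomPlanarGeometry

/-- **Covariance of images** (stub of line `registered`, crux `Rigidity`): if the law of every
Dobrushin domain transports correctly along every continuous plane map complex differentiable on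
the domain and injective on its closure, onto the image Dobrushin domain with the image marks,
then the chordal family is conformally covariant. Reduction to the closure homeomorphism of a
conformal equivalence of Jordan domains (Carathéodory, Pommerenke 1992 Thm. 2.6). [folklore] -/
theorem stub_covarianceOfImages : ∀ P : Literature.Probability.RandomPlanarGeometry.ChordalFamily, (∀ (D₀ D' : Literature.Probability.RandomPlanarGeometry.DobrushinDomain) (Φ : C(ℂ, ℂ)), DifferentiableOn ℂ Φ D₀.carrier → Set.InjOn Φ (closure D₀.carrier) → D'.carrier = Φ '' D₀.carrier → D'.pt 0 = Φ (D₀.pt 0) → D'.pt 1 = Φ (D₀.pt 1) → P D' = (P D₀).map (Literature.Probability.RandomPlanarGeometry.CurveClass.map Φ)) → P.IsConformallyCovariant := by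
  intro P himg D D' g Φ h0 h1 hEq
  obtain ⟨hinj, himD, -, -, ha, hb, -, -⟩ := Cocycle.stub_closureHomeomorph D D' g Φ h0 h1 hEq
  have hdiff : DifferentiableOn ℂ Φ D.carrier := g.differentiableOn_coe.congr hEq
  exact himg D D' Φ hdiff hinj himD.symm ha.symm hb.symm

end Summit.CriticalPhenomena.SAWScalingLimit.Cruxes.Rigidity.Dichotomy

end
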